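/-
Copyright (c) 2026 The decomp-a2c cell. All rights reserved.
Released under Apache 2.0 license as described in the file LICENSE.
-/
import Summits.AtomisticToContinuum.Crystallization.Theorems.ChartedZeroExcessLayeredLatticeLiouvilleWV

/-!
# ChartedZeroExcessLayeredLatticeLiouville — part WW «Reanchor»: re-anchored comparison profiles, slope drift and scale transfer
  (decomp-a2c-lens-2, g58; helper of stmt-AtomisticToContinuum-26636, leaf (PC) `ProfileComparisonAt`; the range-extension step of memo NODE-g58d §3)

The window bootstrap (parts WT/WV) anchored at `x₀` controls the comparison profile `φ x₀.1 − cf` only for `|β − x₀.2| ≲ n/4` (a window of radius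
`|k₀ − x₀.2| + A` around `k₀` must sit inside the data range `n/2`), while (PC) asks for `|β − x₀.2| ≤ n/2`.  The deficit is closed by RE-ANCHORING the
SAME argument at sites `x₁ = (x₀.1, x₀.2 + a)` of the central column (ball `idxBall x₁ (n/2) ⊆ idxBall x₀ n`), with a CORRECTED profile whose mode has
the slope `g₁ = slopeAt φ x₁` and the flux `F₁ = colFlux T φ x₀.1 x₁.2` prescribed at `x₁`.  This part supplies the three `ϱ`-free ingredients:

* `exists_reanchored_profile` (pure algebra on VV `mode_extraction`): for any `cf` with `columnFlux g cf ≡ F` and any `g₁, F₁` there is `cf₁` with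
  `columnFlux g₁ cf₁ ≡ F₁` and `‖Δcf₁(β) − Δcf(β)‖ ≤ modeConst·(‖F₁ − F‖ + 441K(‖g₁ 0
  − g 0‖ + ‖g₁ 1 − g 1‖))` for EVERY `β` — via the additivity
  `columnFlux (g₁ + g₂) (cf₁ + cf₂) = columnFlux g₁ cf₁ + columnFlux g₂ cf₂` (`slopeK_add`, `boxSlope_add`, `columnFlux_add_add`);
* `norm_slopeAt_sub_le` (WM `inPlane_bond_halfBall`): `‖slopeAt φ x₁ j − slopeAt φ x₀ j‖ ≤
  √(864·ipConst)·dist x₁ x₀·√(E/(n²N))` for `x₁` in the half ball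
  (the flux drift `‖F₁ − F‖` is WR `norm_colFlux_drift_le` verbatim);
* `sqrt_ratio_recentred` (WM re-centring ratios): `√(E(idxBall x₁ (n/2))/((n/2)²·#idxBall x₁ (n/2))) ≤ √864·√(E(idxBall x₀ n)/(n²·#idxBall x₀ n))`.

Hence `‖D₃φ(x₀.1, β) − Δcf(β)‖ ≤ ‖D₃φ(x₀.1, β) − Δcf₁(β)‖ + O(|a|·ε₁)`, the first term
bootstrapped at `x₁`; finitely many anchors (`a = 0, ±n/4, ±(3n/8 + O(A₀ +
ϱ/c))`, radius `n/2` each) cover `|β − x₀.2| ≤ n/2` with `ϱ`-free constants.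
-/

namespace Summit.AtomisticToContinuum.Crystallization.Theorems.ChartedZeroExcessLayeredLatticeLiouville

open Summit.AtomisticToContinuum.Crystallization.Theorems.ChartedPlanarOrderRigidityDoor (E3)
open Finset
open scoped InnerProductSpace RealInnerProductSpace BigOperators

noncomputable section Reanchor

variable {c : ℝ} {a b : E3} {w : ℤ → E3}

/-! ### WW.1  Additivity of the column flux in (slope, profile) -/

/-- the slope block is additive in the slope. [formal bookkeeping] -/
theorem slopeK_add (hc : 0 < c) (hL : IsLayeredCrystal c a b w) (ϱ : ℝ) (X : Cell 2 × ℤ) (β : ℤ) (g₁ g₂ : Fin 2 → E3) :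
    slopeK ϱ a b w X β (g₁ + g₂) = slopeK ϱ a b w X β g₁ + slopeK ϱ a b w X β g₂ := by
  have hN : ∀ Y : Cell 2 × ℤ, ‖lsite a b w Y.1 Y.2 - lsite a b w X.1 X.2‖ ≤ ϱ → Y ∈ (finite_near_lsite hc hL X ϱ).toFinset :=
    fun _ hY => (finite_near_lsite hc hL X ϱ).mem_toFinset.mpr hY
  rw [slopeK_eq_sum hN, slopeK_eq_sum hN, slopeK_eq_sum hN, ← sum_add_distrib]
  refine sum_congr rfl fun Y _ => ?_
  rw [← nearK_add]
  congr 1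
  rw [← sum_add_distrib]
  exact sum_congr rfl fun j _ => by rw [Pi.add_apply, smul_add]

/-- the box slope flux is additive in the slope. [formal bookkeeping] -/
theorem boxSlope_add (hc : 0 < c) (hL : IsLayeredCrystal c a b w) (ϱ : ℝ) (r : ℕ) (g₁ g₂ : Fin 2 → E3) (m : ℤ) :
    boxSlope ϱ a b w r (g₁ + g₂) m = boxSlope ϱ a b w r g₁ m + boxSlope ϱ a b w r g₂ m := by
  unfold boxSlope
  rw [← sum_add_distrib]
  refine sum_congr rfl fun α _ => ?_
  rw [← sum_add_distrib]
  exact sum_congr rfl fun β _ => slopeK_add hc hL ϱ _ β g₁ g₂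

/-- ★ the column flux is additive in the pair (slope, profile): `columnFlux (g₁ + g₂) (cf₁ + cf₂) = columnFlux g₁ cf₁ + columnFlux g₂ cf₂`. [this file, g58] -/
theorem columnFlux_add_add (hc : 0 < c) (hL : IsLayeredCrystal c a b w) (ϱ : ℝ) (r : ℕ) (g₁ g₂ : Fin 2 → E3) (cf₁ cf₂ : ℤ → E3) (m : ℤ) :
    columnFlux ϱ a b w r (g₁ + g₂) (cf₁ + cf₂) m = columnFlux ϱ a b w r g₁ cf₁ m + columnFlux ϱ a b w r g₂ cf₂ m := by
  unfold columnFlux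
  rw [← sum_add_distrib]
  refine sum_congr rfl fun α _ => ?_
  rw [← sum_add_distrib]
  refine sum_congr rfl fun β _ => ?_
  rw [Pi.add_apply, Pi.add_apply, add_sub_add_comm, chainK_add hc hL, slopeK_add hc hL]
  abel

/-! ### WW.2  The re-anchored comparison profile -/

/-- ★★ RE-ANCHORING: if `columnFlux g cf ≡ F`, then for any other slope `g₁` and flux `F₁` there is a profile `cf₁` with `columnFlux g₁ cf₁ ≡ F₁` whose
increments differ from those of `cf` by at most `modeConst·(‖F₁ − F‖ + 441K(‖g₁ 0 − g 0‖ +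
‖g₁ 1 − g 1‖))`, uniformly in the layer (`cf₁ = cf + cf_Δ`, `cf_Δ`
the VV mode profile of the difference data). [this file, g58] -/
theorem exists_reanchored_profile (hc : 0 < c) (hL : IsLayeredCrystal c a b w) {κ₀ ε ϱ : ℝ} (hϱ : 0 ≤ ϱ) (hε : ε < 2 * κ₀)
    (hK : CoerciveZ (layeredKernel a b w) κ₀)
    (hT : ∀ φ : Cell 2 → ℤ → E3, HasFiniteSupport φ → Summable (tailFam ϱ a b w φ) ∧ ∑' x, tailFam ϱ a b w φ x ≤ ε * nnFormZ φ)
    (g g₁ : Fin 2 → E3) (cf : ℤ → E3) {F : E3} (hF : ∀ m : ℤ, columnFlux ϱ a b w ⌊ϱ / c⌋₊ g cf m = F) (F₁ : E3) :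
    ∃ cf₁ : ℤ → E3, (∀ m : ℤ, columnFlux ϱ a b w ⌊ϱ / c⌋₊ g₁ cf₁ m = F₁) ∧
      ∀ β : ℤ, ‖(cf₁ (β + 1) - cf₁ β) - (cf (β + 1) - cf β)‖ ≤
        modeConst c (κ₀ - ε / 2) * (‖F₁ - F‖ + 441 * kernelConst c * (‖g₁ 0 - g 0‖ + ‖g₁ 1 - g 1‖)) := by
  obtain ⟨e, -, he, hinc⟩ := mode_extraction hc hL hϱ hε hK hT (g₁ - g) (F₁ - F)
  refine ⟨cf + e, fun m => ?_, fun β => ?_⟩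
  · have h1 := columnFlux_add_add hc hL ϱ ⌊ϱ / c⌋₊ g (g₁ - g) cf e m
    rw [add_sub_cancel] at h1
    rw [h1, hF m, he m, add_sub_cancel]
  · have h2 : (cf + e) (β + 1) - (cf + e) β - (cf (β + 1) - cf β) = e (β + 1) - e β := by
      simp only [Pi.add_apply]
      abel
    rw [h2]
    simpa only [Pi.sub_apply] using hinc β

/-! ### WW.3  Slope drift and scale transfer -/

/-- the first slope component is the first axis increment. [formal bookkeeping] -/
theorem slopeAt_zero_eq (φ : Cell 2 → ℤ → E3) (x : Cell 2 × ℤ) : slopeAt φ x 0 = latDiff idxAxis₁ φ x.1 x.2 := rfl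

/-- the second slope component is the second axis increment. [formal bookkeeping] -/
theorem slopeAt_one_eq (φ : Cell 2 → ℤ → E3) (x : Cell 2 × ℤ) : slopeAt φ x 1 = latDiff idxAxis₂ φ x.1 x.2 := rfl

/-- ★ SLOPE DRIFT ON THE HALF BALL: `‖slopeAt φ x₁ j − slopeAt φ x₀ j‖ ≤ √(864·ipConst)·dist x₁ x₀·√(E/(n²·N))` for `x₁ ∈ idxBall x₀ (n/2)`
(WM `inPlane_bond_halfBall`). [this file, g58] -/
theorem norm_slopeAt_sub_le (hc : 0 < c) (hL : IsLayeredCrystal c a b w) {κ₀ ε ϱ : ℝ} (hκ₀ : 0 < κ₀) (hϱ : 0 ≤ ϱ) (hε : ε < 2 * κ₀)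
    (hK : CoerciveZ (layeredKernel a b w) κ₀)
    (hT : ∀ φ : Cell 2 → ℤ → E3, HasFiniteSupport φ → Summable (tailFam ϱ a b w φ) ∧ ∑' x, tailFam ϱ a b w φ x ≤ ε * nnFormZ φ)
    (hP : ∀ E₀ : Cell 2 × ℤ, E₀.2 = 0 → (idxNorm E₀ : ℝ) ≤ 1 → ∀ (y₀ : Cell 2 × ℤ) (r' n' : ℝ), r' < n' → ∀ χ : Cell 2 → ℤ → E3,
      IsTruncHarmonicZ ϱ a b w χ (idxBall y₀ (n' + 1)) →
        κ₀ * idxEnergy (latDiff E₀ χ) (idxBall y₀ r') ≤ 54 * kernelConst c * ((n' - r')⁻¹) ^ 2 * idxEnergy χ (idxBall y₀ (n' + ϱ / c + 1)))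
    (x₀ : Cell 2 × ℤ) {n : ℝ} (hn : 512 * (ϱ / c + 2) ≤ n) {φ : Cell 2 → ℤ → E3} (hφ : IsTruncHarmonicZ ϱ a b w φ (idxBall x₀ n))
    {x₁ : Cell 2 × ℤ} (hx₁ : x₁ ∈ idxBall x₀ (n / 2)) (j : Fin 2) :
    ‖slopeAt φ x₁ j - slopeAt φ x₀ j‖ ≤
      Real.sqrt (864 * ipConst c κ₀ ε) * dist x₁ x₀ * Real.sqrt (idxEnergy φ (idxBall x₀ n) / (n ^ 2 * ((idxBall x₀ n).ncard : ℝ))) := by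
  have hϱc : 0 ≤ ϱ / c := div_nonneg hϱ hc.le
  have hn0 : 0 < n := by linarith
  have hN := ncard_idxBall_pos x₀ hn0.le
  have hip := ipConst_nonneg hc hκ₀ ε
  have key : ∀ E : Cell 2 × ℤ, E.2 = 0 → (idxNorm E : ℝ) ≤ 1 → ‖latDiff E φ x₁.1 x₁.2 - latDiff E φ x₀.1 x₀.2‖ ≤
      Real.sqrt (864 * ipConst c κ₀ ε) * dist x₁ x₀ * Real.sqrt (idxEnergy φ (idxBall x₀ n) / (n ^ 2 * ((idxBall x₀ n).ncard : ℝ))) := by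
    intro E hE hE1
    have h := inPlane_bond_halfBall hc hL hκ₀ hϱ hε hK hT hP x₀ hn hφ hE hE1 hx₁
    have h1 := norm_le_sqrt_of_sq (by positivity : (0 : ℝ) < n ^ 2 * ((idxBall x₀ n).ncard : ℝ)) h
    refine h1.trans (le_of_eq ?_)
    rw [show 864 * ipConst c κ₀ ε * dist x₁ x₀ ^ 2 * idxEnergy φ (idxBall x₀ n) / (n ^ 2 * ((idxBall x₀ n).ncard : ℝ)) =
      864 * ipConst c κ₀ ε * dist x₁ x₀ ^ 2 * (idxEnergy φ (idxBall x₀ n) / (n ^ 2 * ((idxBall x₀ n).ncard : ℝ))) by ring,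
      Real.sqrt_mul (by positivity : (0 : ℝ) ≤ 864 * ipConst c κ₀ ε * dist x₁ x₀ ^ 2),
      Real.sqrt_mul (by positivity : (0 : ℝ) ≤ 864 * ipConst c κ₀ ε) (dist x₁ x₀ ^ 2), Real.sqrt_sq dist_nonneg]
  revert j
  rw [Fin.forall_fin_two]
  exact ⟨by rw [slopeAt_zero_eq, slopeAt_zero_eq]; exact key _ rfl idxNorm_idxAxis₁_le,
    by rw [slopeAt_one_eq, slopeAt_one_eq]; exact key _ rfl idxNorm_idxAxis₂_le⟩

/-- ★ SCALE TRANSFER: the energy scale of a re-centred half-radius ball is at most `√864` times that of the big ball,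
`√(E(idxBall x₁ (n/2))/((n/2)²·#idxBall x₁ (n/2))) ≤ √864·√(E(idxBall x₀ n)/(n²·#idxBall x₀
n))` for `x₁ ∈ idxBall x₀ (n/2)`, `n ≥ 1`. [this file, g58] -/
theorem sqrt_ratio_recentred (φ : Cell 2 → ℤ → E3) (x₀ : Cell 2 × ℤ) {n : ℝ} (hn : 1 ≤ n) {x₁ : Cell 2 × ℤ} (hx₁ : x₁ ∈ idxBall x₀ (n / 2)) :
    Real.sqrt (idxEnergy φ (idxBall x₁ (n / 2)) / ((n / 2) ^ 2 * ((idxBall x₁ (n / 2)).ncard : ℝ))) ≤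
      Real.sqrt 864 * Real.sqrt (idxEnergy φ (idxBall x₀ n) / (n ^ 2 * ((idxBall x₀ n).ncard : ℝ))) := by
  have hEZ : idxEnergy φ (idxBall x₁ (n / 2)) ≤ idxEnergy φ (idxBall x₀ n) :=
    idxEnergy_le_of_dist φ (by have h' : dist x₁ x₀ ≤ n / 2 := hx₁; linarith)
  have h := recentre_ratio_le (zero_le_one : (0 : ℝ) ≤ 1) (idxEnergy_nonneg _ _) hEZ (ncard_idxBall_pos x₁ (by positivity))
    (ncard_le_recentred x₀ x₁ hn) (ncard_idxBall_pos x₀ (by positivity)) (by positivity)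
  rw [one_mul, mul_one, show 864 * idxEnergy φ (idxBall x₀ n) / (n ^ 2 * ((idxBall x₀ n).ncard : ℝ)) =
    864 * (idxEnergy φ (idxBall x₀ n) / (n ^ 2 * ((idxBall x₀ n).ncard : ℝ))) by ring] at h
  rw [← Real.sqrt_mul (by norm_num : (0 : ℝ) ≤ 864)]
  exact Real.sqrt_le_sqrt h

/-! ### WW.4  The closed statement of this part -/

/-- The content of part WW as one closed proposition: additivity of the column flux, the re-anchored profile, the slope drift and the scale transfer. -/
def ReanchorShape : Prop :=
  (∀ c : ℝ, ∀ hc : 0 < c, ∀ (a b : E3) (w : ℤ → E3), ∀ hL : IsLayeredCrystal c a b w,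
    (∀ (ϱ : ℝ) (r : ℕ) (g₁ g₂ : Fin 2 → E3) (m : ℤ), boxSlope ϱ a b w r (g₁ + g₂) m = boxSlope ϱ a b w r g₁ m + boxSlope ϱ a b w r g₂ m) ∧
    (∀ (ϱ : ℝ) (r : ℕ) (g₁ g₂ : Fin 2 → E3) (cf₁ cf₂ : ℤ → E3) (m : ℤ),
      columnFlux ϱ a b w r (g₁ + g₂) (cf₁ + cf₂) m = columnFlux ϱ a b w r g₁ cf₁ m + columnFlux ϱ a b w r g₂ cf₂ m) ∧
    (∀ κ₀ ε ϱ : ℝ, 0 ≤ ϱ → ε < 2 * κ₀ → CoerciveZ (layeredKernel a b w) κ₀ →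
      (∀ φ : Cell 2 → ℤ → E3, HasFiniteSupport φ → Summable (tailFam ϱ a b w φ) ∧ ∑' x, tailFam ϱ a b w φ x ≤ ε * nnFormZ φ) →
      ∀ (g g₁ : Fin 2 → E3) (cf : ℤ → E3) (F : E3), (∀ m : ℤ, columnFlux ϱ a b w ⌊ϱ / c⌋₊ g cf m = F) → ∀ F₁ : E3,
        ∃ cf₁ : ℤ → E3, (∀ m : ℤ, columnFlux ϱ a b w ⌊ϱ / c⌋₊ g₁ cf₁ m = F₁) ∧
          ∀ β : ℤ, ‖(cf₁ (β + 1) - cf₁ β) - (cf (β + 1) - cf β)‖ ≤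
            modeConst c (κ₀ - ε / 2) * (‖F₁ - F‖ + 441 * kernelConst c * (‖g₁ 0 - g 0‖ + ‖g₁ 1 - g 1‖))) ∧
    ∀ κ₀ ε ϱ : ℝ, 0 < κ₀ → 0 ≤ ϱ → ε < 2 * κ₀ → CoerciveZ (layeredKernel a b w) κ₀ →
      (∀ φ : Cell 2 → ℤ → E3, HasFiniteSupport φ → Summable (tailFam ϱ a b w φ) ∧ ∑' x, tailFam ϱ a b w φ x ≤ ε * nnFormZ φ) →
      (∀ E₀ : Cell 2 × ℤ, E₀.2 = 0 → (idxNorm E₀ : ℝ) ≤ 1 → ∀ (y₀ : Cell 2 × ℤ) (r' n' : ℝ), r' < n' → ∀ χ : Cell 2 → ℤ → E3,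
        IsTruncHarmonicZ ϱ a b w χ (idxBall y₀ (n' + 1)) →
          κ₀ * idxEnergy (latDiff E₀ χ) (idxBall y₀ r') ≤ 54 * kernelConst c * ((n' - r')⁻¹) ^ 2 * idxEnergy χ (idxBall y₀ (n' + ϱ / c + 1))) →
      ∀ (x₀ : Cell 2 × ℤ) (n : ℝ), 512 * (ϱ / c + 2) ≤ n → ∀ φ : Cell 2 → ℤ → E3, IsTruncHarmonicZ ϱ a b w φ (idxBall x₀ n) →
        ∀ x₁ : Cell 2 × ℤ, x₁ ∈ idxBall x₀ (n / 2) → ∀ j : Fin 2,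
          ‖slopeAt φ x₁ j - slopeAt φ x₀ j‖ ≤
            Real.sqrt (864 * ipConst c κ₀ ε) * dist x₁ x₀ * Real.sqrt (idxEnergy φ (idxBall x₀ n) / (n ^ 2 * ((idxBall x₀ n).ncard : ℝ)))) ∧
  ∀ (φ : Cell 2 → ℤ → E3) (x₀ : Cell 2 × ℤ) (n : ℝ), 1 ≤ n → ∀ x₁ : Cell 2 × ℤ, x₁ ∈ idxBall x₀ (n / 2) →
    Real.sqrt (idxEnergy φ (idxBall x₁ (n / 2)) / ((n / 2) ^ 2 * ((idxBall x₁ (n / 2)).ncard : ℝ))) ≤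
      Real.sqrt 864 * Real.sqrt (idxEnergy φ (idxBall x₀ n) / (n ^ 2 * ((idxBall x₀ n).ncard : ℝ)))

/-- WW holds. [this file, g58] -/
theorem reanchorShape_holds : ReanchorShape :=
  ⟨fun _c hc _a _b _w hL =>
    ⟨fun ϱ r g₁ g₂ m => boxSlope_add hc hL ϱ r g₁ g₂ m, fun ϱ r g₁ g₂ cf₁ cf₂ m => columnFlux_add_add hc hL ϱ r g₁ g₂ cf₁ cf₂ m,
      fun _κ₀ _ε _ϱ hϱ hε hK hT g g₁ cf _F hF F₁ => exists_reanchored_profile hc hL hϱ hε hK hT g g₁ cf hF F₁,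
      fun _κ₀ _ε _ϱ hκ₀ hϱ hε hK hT hP x₀ _n hn _φ hφ _x₁ hx₁ j => norm_slopeAt_sub_le hc hL hκ₀ hϱ hε hK hT hP x₀ hn hφ hx₁ j⟩,
    fun φ x₀ _n hn _x₁ hx₁ => sqrt_ratio_recentred φ x₀ hn hx₁⟩

end Reanchor

end Summit.AtomisticToContinuum.Crystallization.Theorems.ChartedZeroExcessLayeredLatticeLiouville
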